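import Summits.ABC.StewartYu.PadicG3TwoRecordL1
import Summits.ABC.StewartYu.PadicG3TwoScheduleS
import HarnessLib

/-!
# Cell abc-stewartyu, Gen-3 frame at `p = 2` (crux `Y07Two`, stmt-ABC-19659), record interface: the Siegel line (L1)
# for the schedule of record `schedTwoS` (transfer of p1's `hL1_schedTwo`; the level-`0` data are identical)

`Summits/ABC/StewartYu/PadicG3TwoRecordL1S.lean` — cell `abc-stewartyu` (HOME `run/shared/lean/pub/abc-stewartyu/`),
route `PadicPrimesKummerThird`, seat p5 (g3); on p1's `PadicG3TwoRecordL1` (p488753) and p5's `PadicG3TwoScheduleS`.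
Theorems only.  `schedTwoS S P` and `schedTwo S P` have the SAME level-`0` data (`m`, `N0 0 = X`, `T0 0 = T03 0`,
`Dbox 0 = Dbox3 P 0`, `Dθ 0 = Dθ3 P 0`), so p1's binomial Siegel count transfers verbatim: **`hL1_schedTwoS`** — the
hypothesis `hL1` of `frameNumericsTwoR_schedTwoS`.

References: Yu. V. Nesterenko, LNM 1819 (2003), §3.5 (3.48); K. Yu, Acta Math. 211 (2013), (4.30).
-/

noncomputable section

open Finset

namespace Summit.ABC.StewartYu

namespace TwoSetup

variable (S : TwoSetup) (P : PadicG3Par (S.d + 1))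

/-- **(L1) for the schedule of record**: `2·2^m·(2X+1)·binom(T₀+d, d+1) ≤ (L₀+1)·∏(2·Dbox3 0 j+1)·(2·Dθ3 0+1)` on the
projections of `schedTwoS`. [cite: Nesterenko2003, §3.5 (3.48); shape only] -/
theorem hL1_schedTwoS :
    2 * 2 ^ (S.schedTwoS P).m *
        ((2 * (S.schedTwoS P).N0 0 + 1) * ((S.schedTwoS P).T0 0 + S.d).choose (S.d + 1)) ≤
      (P.L₀ + 1) * ((∏ j, (2 * (S.schedTwoS P).Dbox 0 j + 1)) * (2 * (S.schedTwoS P).Dθ 0 + 1)) := by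
  have h := S.hL1_schedTwo P
  simp only [schedTwo_m, schedTwo_N0, schedTwo_T0, schedTwo_Dbox, schedTwo_Dθ] at h
  simp only [schedTwoS_m, schedTwoS_N0, schedTwoS_T0, schedTwoS_Dbox, schedTwoS_Dθ, Dbox3R_zero, Dθ3R_zero]
  exact h

end TwoSetup

end Summit.ABC.StewartYu

end
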